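import Summits.HodgeConjecture.HodgeConjecture.Theses.EndoscopicMiddleDegree
import Summits.HodgeConjecture.HodgeConjecture.Theorems.EndoscopicMiddleDegreeOrthogonalEnvelopedRationalFitting
import Literature.AlgebraicGeometry.HodgeTheory.ComplexGysinCorrespondence
import Literature.AlgebraicGeometry.HodgeTheory.SupportedClassesRationalProofs
import Literature.AlgebraicGeometry.HodgeTheory.RationalLattice
import Literature.AlgebraicGeometry.HodgeTheory.RationalClassesRingChange
import HarnessLib

/-!
# Reduction to idempotent correspondences (stub `stub_idempotentReduction`, line `virtual-lefschetz-noncongruence`)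

Support file for the crux `IsotypicMiddleClassesAlgebraic` (item `stmt-HodgeConjecture-14301`) of
the route `Summits/HodgeConjecture/HodgeConjecture/Theses/EndoscopicMiddleDegree`, line
`virtual-lefschetz-noncongruence`, stub S2. For `X` smooth projective of dimension `2n` (`n = m + 1`),
granted that actions `γ_* = corrAction μ hX hX rfl γ` of ALGEBRAIC self-correspondences
`γ ∈ N^{2n} H^{4n}((X ⊗ X)(ℂ); ℂ)` compose (hypothesis `hcomp`, the line's proved S1): for an
algebraic `γ` whose action `P` preserves rational classes (H2) and has image of Hodge type `(n,n)`
(H3), and a rational class `c` with `P c = c`, there is an algebraic `γ'` whose action `P'` again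
satisfies H2 and H3, is IDEMPOTENT, and still fixes `c`.

PROOF (Fitting decomposition of `ℚ[P]`, Voisin I §7.1.1 for the rational structure). `P` descends
to `P_ℚ` on the finite-dimensional `V = H^{2n}(X(ℂ); ℚ)` along the injective change of coefficients
`ι` (`ratFit_exists_descent`; `finite_singularCohomology_rat_complexPoints`). Factor
`minpoly ℚ P_ℚ = X^a · g` with `X ∤ g`, Bezout `u X^(a+1) + v g = 1`, and put `e := X · (u X^a)`
(NO constant term), `P' := e^ℂ(P)`. Then: (i) `e(P_ℚ)` is idempotent (`e² - e = -u v X · minpoly`),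
and idempotence transfers to `P'` along `ι` because the rational classes span
(`span_isRationalClass_eq_top_of_isSmoothProjective_holds`, `LinearMap.ext_on`); (ii) `e(P_ℚ)`
fixes every `P_ℚ`-fixed vector `x` (`1 - e = v g` and
`(v g)(P_ℚ) x = (v g)(P_ℚ) P_ℚ^a x = (v · minpoly)(P_ℚ) x = 0`), so `P'` fixes `c = ι x`;
(iii) `P'` is a `ℂ`-combination of powers `P^i`, `i ≥ 1`, each the action of an algebraic class by
`hcomp` and induction, so `P' = (γ')_*` with `γ'` algebraic by linearity of `corrAction` in `γ`;
(iv) `P'(ι x) = ι(e(P_ℚ) x)` is rational; (v) `P' = P ∘ (u X^a)^ℂ(P)` has image inside the image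
of `P`, of type `(n,n)`.

The linear algebra is proved for an abstract "action" `T : G →ₗ[ℂ] End_ℂ(Hᵏ(Y; ℂ))` and an
abstract submodule `A ≤ G` closed under composition of actions
(`idempotentReduction_of_comp`), then specialised to `T = corrAction μ hX hX rfl`,
`A = algebraicClasses (X ⊗ X) (2n)`.
-/

noncomputable section

-- `Summit.HodgeConjecture.HodgeConjecture.Theorems` is the mandated namespace (single-problem summit),
-- flagged by `linter.dupNamespace` on every declaration.
set_option linter.dupNamespace false

open scoped BigOperators
open CategoryTheory MonoidalCategory CartesianMonoidalCategory
open Literature.AlgebraicGeometry Literature.AlgebraicGeometry.Motives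
open Literature.AlgebraicGeometry.HodgeTheory
open Literature.AlgebraicTopology.SingularHomology
open Summit.HodgeConjecture.HodgeConjecture.Cruxes.OrthogonalEnveloped.MiddleInvolutionPurity
open Polynomial

namespace Summit.HodgeConjecture.HodgeConjecture.Theorems

universe u

/-! ### Actions closed under composition: powers and polynomials without constant term -/

section CompClosure

variable {R G H : Type*} [CommSemiring R] [AddCommMonoid G] [Module R G] [AddCommGroup H]
  [Module R H] (A : Submodule R G) (T : G →ₗ[R] Module.End R H)

/-- If the actions `T γ` of the members `γ` of a submodule `A` are closed under composition, then
every positive power `(T γ)^(n+1)` of the action of `γ ∈ A` is the action of a member of `A`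
(induction on `n`). [folklore] -/
theorem idemRed_exists_mem_eq_pow
    (hcomp : ∀ γ₁ ∈ A, ∀ γ₂ ∈ A, ∃ γ₃ : G, γ₃ ∈ A ∧ ∀ β, T γ₃ β = T γ₁ (T γ₂ β))
    (γ : G) (hγ : γ ∈ A) (n : ℕ) : ∃ γn : G, γn ∈ A ∧ T γn = T γ ^ (n + 1) := by
  induction n with
  | zero => exact ⟨γ, hγ, (pow_one _).symm⟩
  | succ n ih =>
    obtain ⟨γn, hγn, hT⟩ := ih
    obtain ⟨γ₃, hγ₃, h⟩ := hcomp γ hγ γn hγn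
    refine ⟨γ₃, hγ₃, ?_⟩
    rw [pow_succ', ← hT]
    exact LinearMap.ext fun β ↦ (h β).trans (Module.End.mul_apply _ _ _).symm

/-- If the actions `T γ` of the members `γ` of a submodule `A` are closed under composition, then
for `γ ∈ A` and every polynomial `p`, the endomorphism `(X · p)(T γ)` (a combination of POSITIVE
powers of `T γ`) is the action of a member of `A` (linearity of `T`). [folklore] -/
theorem idemRed_exists_mem_eq_aeval_X_mul
    (hcomp : ∀ γ₁ ∈ A, ∀ γ₂ ∈ A, ∃ γ₃ : G, γ₃ ∈ A ∧ ∀ β, T γ₃ β = T γ₁ (T γ₂ β))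
    (γ : G) (hγ : γ ∈ A) (p : R[X]) : ∃ γp : G, γp ∈ A ∧ T γp = aeval (T γ) (X * p) := by
  induction p using Polynomial.induction_on' with
  | add p q hp hq =>
    obtain ⟨γp, hγp, hTp⟩ := hp
    obtain ⟨γq, hγq, hTq⟩ := hq
    exact ⟨γp + γq, A.add_mem hγp hγq, by rw [map_add, hTp, hTq, mul_add, map_add]⟩
  | monomial n a =>
    obtain ⟨γn, hγn, hTn⟩ := idemRed_exists_mem_eq_pow A T hcomp γ hγ n
    refine ⟨a • γn, A.smul_mem a hγn, ?_⟩
    rw [map_smul, hTn, X_mul_monomial, aeval_monomial, Algebra.smul_def]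

end CompClosure

/-! ### Pure algebra: the Fitting idempotent fixes the fixed vectors -/

/-- **Fitting/CRT idempotent of `K[f]`, with fixed vectors.** For an endomorphism `f` of a
`K`-module (`K` a field) that is integral over `K`, there is `p ∈ K[X]` such that `(X p)(f)` is
idempotent and `(X p)(f) x = x` whenever `f x = x`. (Factor `minpoly K f = X^a g`, `X ∤ g`; Bezout
`u X^(a+1) + v g = 1`; take `X p = u X^(a+1)`: then `(Xp)² - Xp = -u v X · minpoly`, and
`1 - X p = v g` kills every fixed vector since `(v g)(f) x = (v g)(f) f^a x = (v · minpoly)(f) x`.)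
[folklore] -/
theorem idemRed_exists_poly_idempotent_fix {K V : Type*} [Field K] [AddCommGroup V] [Module K V]
    {f : Module.End K V} (hf : IsIntegral K f) :
    ∃ p : K[X], IsIdempotentElem (aeval f (X * p)) ∧ ∀ x, f x = x → aeval f (X * p) x = x := by
  -- adapted from `ratFit_exists_poly_idempotent` (Theorems/EndoscopicMiddleDegreeOrthogonalEnvelopedRationalFitting)
  obtain ⟨a, g, hμ, hg⟩ : ∃ (a : ℕ) (g : K[X]), minpoly K f = X ^ a * g ∧ ¬ X ∣ g := by
    obtain ⟨g, hμ, hg⟩ :=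
      (minpoly K f).exists_eq_pow_rootMultiplicity_mul_and_not_dvd (minpoly.ne_zero hf) 0
    rw [C_0, sub_zero] at hμ hg
    exact ⟨_, g, hμ, hg⟩
  have hcop : IsCoprime (X ^ (a + 1)) g :=
    (Polynomial.irreducible_X.coprime_iff_not_dvd.2 hg).pow_left
  obtain ⟨u, v, huv⟩ := id hcop
  refine ⟨u * X ^ a, ?_, fun x hx ↦ ?_⟩
  · -- idempotent: `(Xp)·(Xp) = Xp + (-(u v X)) · minpoly`
    have hkey : X * (u * X ^ a) * (X * (u * X ^ a)) =
        X * (u * X ^ a) + -(u * v * X) * minpoly K f := by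
      rw [hμ]; linear_combination (X * (u * X ^ a)) * huv
    change aeval f _ * aeval f _ = aeval f _
    rw [← map_mul, hkey, map_add, map_mul (aeval f) (-(u * v * X)), minpoly.aeval, mul_zero,
      add_zero]
  · -- fixed vectors: `1 - Xp = v g`, `(v g)(f) x = (v g X^a)(f) x = (v · minpoly)(f) x = 0`
    have hpow : ∀ n : ℕ, (f ^ n) x = x := fun n ↦ by
      induction n with
      | zero => rw [pow_zero, Module.End.one_apply]
      | succ n ih => rw [pow_succ, Module.End.mul_apply, hx, ih]
    have hvg : aeval f (v * g) x = 0 := by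
      have h1 : aeval f (v * minpoly K f) x = aeval f (v * g) x := by
        rw [hμ, show v * (X ^ a * g) = v * g * X ^ a by ring, map_mul (aeval f) (v * g),
          Module.End.mul_apply, map_pow, aeval_X, hpow]
      rw [← h1, map_mul, Module.End.mul_apply, minpoly.aeval, LinearMap.zero_apply, map_zero]
    rw [show X * (u * X ^ a) = 1 - v * g by linear_combination huv, map_sub, map_one,
      LinearMap.sub_apply, Module.End.one_apply, hvg, sub_zero]

/-! ### The reduction, for an abstract composition-closed family of actions on `Hᵏ(Y; ℂ)` -/

/-- **Idempotent reduction, abstract form.** Let `Y` be a space with `Hᵏ(Y; ℚ)` finite-dimensional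
and `Hᵏ(Y; ℂ)` spanned by its rational classes, `T : G →ₗ End(Hᵏ(Y; ℂ))` a linear "action" and
`A ≤ G` a submodule whose actions are closed under composition. For `γ ∈ A` whose action preserves
rational classes, has image inside a predicate `Hdg`, and fixes a rational class `c`, some `γ' ∈ A`
has an IDEMPOTENT action which still preserves rational classes, has image inside `Hdg`, and fixes
`c`: `T γ' = e^ℂ(T γ)` for the Fitting idempotent `e = X p ∈ ℚ[X]` of the descent of `T γ` to
`Hᵏ(Y; ℚ)` (`idemRed_exists_poly_idempotent_fix`, `ratFit_exists_descent`,
`ratFit_aeval_map_apply_ringChange`, `idemRed_exists_mem_eq_aeval_X_mul`).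
[cite: VoisinHodgeI2002, §7.1.1] -/
theorem idempotentReduction_of_comp {Y : Type u} [TopologicalSpace Y] {k : ℕ}
    [Module.Finite ℚ (singularCohomology ℚ ℚ Y k)]
    (hspan : Submodule.span ℂ {c : singularCohomology ℂ ℂ Y k | IsRationalClass c} = ⊤)
    {G : Type*} [AddCommGroup G] [Module ℂ G] (A : Submodule ℂ G)
    (T : G →ₗ[ℂ] Module.End ℂ (singularCohomology ℂ ℂ Y k))
    (hcomp : ∀ γ₁ ∈ A, ∀ γ₂ ∈ A, ∃ γ₃ : G, γ₃ ∈ A ∧ ∀ β, T γ₃ β = T γ₁ (T γ₂ β))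
    (Hdg : singularCohomology ℂ ℂ Y k → Prop) (γ : G) (hγ : γ ∈ A)
    (hPrat : ∀ β, IsRationalClass β → IsRationalClass (T γ β)) (hPhdg : ∀ β, Hdg (T γ β))
    (c : singularCohomology ℂ ℂ Y k) (hc : IsRationalClass c) (hPc : T γ c = c) :
    ∃ γ' : G, γ' ∈ A ∧ (∀ β, IsRationalClass β → IsRationalClass (T γ' β)) ∧
      (∀ β, Hdg (T γ' β)) ∧ (∀ β, T γ' (T γ' β) = T γ' β) ∧ T γ' c = c := by
  -- descent of `P = T γ` to `Hᵏ(Y; ℚ)` and its Fitting idempotent `e = X p`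
  obtain ⟨Pq, hPq⟩ := ratFit_exists_descent (T γ) hPrat
  obtain ⟨p, hidem, hfix⟩ :=
    idemRed_exists_poly_idempotent_fix (Algebra.IsIntegral.isIntegral (R := ℚ) Pq)
  -- `e^ℂ(P)` is the action of some `γ' ∈ A`
  obtain ⟨γ', hγ'A, hTγ'⟩ :=
    idemRed_exists_mem_eq_aeval_X_mul A T hcomp γ hγ (p.map (algebraMap ℚ ℂ))
  -- transfer along `ι`: `e^ℂ(P) (ι x) = ι (e(P_ℚ) x)`
  have htr : ∀ x, aeval (T γ) (X * p.map (algebraMap ℚ ℂ))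
      (singularCohomology.ringChange (algebraMap ℚ ℂ) Y k x) =
      singularCohomology.ringChange (algebraMap ℚ ℂ) Y k (aeval Pq (X * p) x) := by
    intro x
    rw [← ratFit_aeval_map_apply_ringChange (T γ) Pq hPq (X * p) x, Polynomial.map_mul,
      Polynomial.map_X]
  refine ⟨γ', hγ'A, fun β hβ ↦ ?_, fun β ↦ ?_, fun β ↦ ?_, ?_⟩
  · -- H2: rational to rational
    obtain ⟨x, rfl⟩ := (isRationalClass_iff_exists_ringChange β).1 hβ
    rw [hTγ', htr]
    exact isRationalClass_ringChange _
  · -- H3: `e^ℂ(P) = P ∘ p^ℂ(P)`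
    rw [hTγ', map_mul, aeval_X, Module.End.mul_apply]
    exact hPhdg _
  · -- idempotence, transferred from `Hᵏ(Y; ℚ)` to the span of the rational classes
    have hidC : IsIdempotentElem (aeval (T γ) (X * p.map (algebraMap ℚ ℂ))) := by
      refine LinearMap.ext_on hspan ?_
      rintro c' hc'
      obtain ⟨x, rfl⟩ := (isRationalClass_iff_exists_ringChange c').1 hc'
      rw [Module.End.mul_apply, htr, htr, ← Module.End.mul_apply, hidem.eq]
    rw [hTγ', ← Module.End.mul_apply, hidC.eq]
  · -- `c = ι x` with `P_ℚ x = x`, fixed by `e(P_ℚ)`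
    obtain ⟨x, rfl⟩ := (isRationalClass_iff_exists_ringChange c).1 hc
    have hx : Pq x = x := ringChange_rat_injective (by rw [hPq]; exact hPc)
    rw [hTγ', htr, hfix x hx]

/-! ### The stub -/

/-- **Stub S2 (`stub_idempotentReduction`) of line `virtual-lefschetz-noncongruence` — it suffices to
treat admissible IDEMPOTENTS.** Granted composition closure of the actions of algebraic
self-correspondences of codimension `2n` on the smooth projective `2n`-fold `X` (`n = m + 1`): for an
algebraic `γ` whose action `P = corrAction μ hX hX rfl γ` preserves rational classes (H2) and has
purely `(n,n)` image (H3), and a rational `c` with `P c = c`, there is an algebraic `γ'` whose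
action `P'` again satisfies H2 and H3, is IDEMPOTENT, and fixes `c` — `P' = e^ℂ(P)` for the Fitting
idempotent `e = u X^(a+1) ∈ ℚ[X]` of the descent of `P` to `H^{2n}(X(ℂ); ℚ)`
(`idempotentReduction_of_comp` with `T = corrAction μ hX hX rfl`, `A = algebraicClasses (X ⊗ X) (2n)`;
`finite_singularCohomology_rat_complexPoints`, `span_isRationalClass_eq_top_of_isSmoothProjective_holds`).
[cite: VoisinHodgeI2002, §7.1.1] -/
theorem stub_idempotentReduction (μ : OrientationFamily) (hμ : μ.HasPoincareDuality) (m : ℕ)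
    (X : SchemeOver ℂ) (hX : IsSmoothProjective (2 * (m + 1)) X)
    (hcomp : ∀ γ₁ ∈ algebraicClasses (X ⊗ X) (2 * (m + 1)),
      ∀ γ₂ ∈ algebraicClasses (X ⊗ X) (2 * (m + 1)),
      ∃ γ₃ : complexBetti (X ⊗ X) (2 * (2 * (m + 1))),
        γ₃ ∈ algebraicClasses (X ⊗ X) (2 * (m + 1)) ∧
        ∀ β : complexBetti X (2 * (m + 1)),
          corrAction μ hX hX
              (rfl : 2 * (m + 1) + 2 * (2 * (m + 1)) = 2 * (m + 1) + 2 * (2 * (m + 1))) γ₃ β =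
            corrAction μ hX hX
              (rfl : 2 * (m + 1) + 2 * (2 * (m + 1)) = 2 * (m + 1) + 2 * (2 * (m + 1))) γ₁
              (corrAction μ hX hX
                (rfl : 2 * (m + 1) + 2 * (2 * (m + 1)) = 2 * (m + 1) + 2 * (2 * (m + 1))) γ₂ β))
    (γ : complexBetti (X ⊗ X) (2 * (2 * (m + 1))))
    (hγ : γ ∈ algebraicClasses (X ⊗ X) (2 * (m + 1)))
    (hPrat : ∀ β, IsRationalClass β → IsRationalClass (corrAction μ hX hX
      (rfl : 2 * (m + 1) + 2 * (2 * (m + 1)) = 2 * (m + 1) + 2 * (2 * (m + 1))) γ β))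
    (hPhdg : ∀ β, IsOfHodgeType (2 * (m + 1)) X (2 * (m + 1)) (m + 1) (m + 1)
      (corrAction μ hX hX
        (rfl : 2 * (m + 1) + 2 * (2 * (m + 1)) = 2 * (m + 1) + 2 * (2 * (m + 1))) γ β))
    (c : complexBetti X (2 * (m + 1))) (hc : IsRationalClass c)
    (hPc : corrAction μ hX hX
      (rfl : 2 * (m + 1) + 2 * (2 * (m + 1)) = 2 * (m + 1) + 2 * (2 * (m + 1))) γ c = c) :
    ∃ γ' : complexBetti (X ⊗ X) (2 * (2 * (m + 1))),
      γ' ∈ algebraicClasses (X ⊗ X) (2 * (m + 1)) ∧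
      (∀ β, IsRationalClass β → IsRationalClass (corrAction μ hX hX
        (rfl : 2 * (m + 1) + 2 * (2 * (m + 1)) = 2 * (m + 1) + 2 * (2 * (m + 1))) γ' β)) ∧
      (∀ β, IsOfHodgeType (2 * (m + 1)) X (2 * (m + 1)) (m + 1) (m + 1)
        (corrAction μ hX hX
          (rfl : 2 * (m + 1) + 2 * (2 * (m + 1)) = 2 * (m + 1) + 2 * (2 * (m + 1))) γ' β)) ∧
      (∀ β, corrAction μ hX hX
          (rfl : 2 * (m + 1) + 2 * (2 * (m + 1)) = 2 * (m + 1) + 2 * (2 * (m + 1))) γ'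
          (corrAction μ hX hX
            (rfl : 2 * (m + 1) + 2 * (2 * (m + 1)) = 2 * (m + 1) + 2 * (2 * (m + 1))) γ' β) =
        corrAction μ hX hX
          (rfl : 2 * (m + 1) + 2 * (2 * (m + 1)) = 2 * (m + 1) + 2 * (2 * (m + 1))) γ' β) ∧
      corrAction μ hX hX
        (rfl : 2 * (m + 1) + 2 * (2 * (m + 1)) = 2 * (m + 1) + 2 * (2 * (m + 1))) γ' c = c := by
  have _ := hμ -- the orientation family need not have Poincaré duality for this reduction
  haveI := finite_singularCohomology_rat_complexPoints hX (2 * (m + 1))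
  exact idempotentReduction_of_comp
    (span_isRationalClass_eq_top_of_isSmoothProjective_holds (2 * (m + 1)) X hX (2 * (m + 1)))
    (algebraicClasses (X ⊗ X) (2 * (m + 1)))
    (corrAction μ hX hX (rfl : 2 * (m + 1) + 2 * (2 * (m + 1)) = 2 * (m + 1) + 2 * (2 * (m + 1))))
    hcomp (IsOfHodgeType (2 * (m + 1)) X (2 * (m + 1)) (m + 1) (m + 1)) γ hγ hPrat hPhdg c hc hPc

end Summit.HodgeConjecture.HodgeConjecture.Theorems

end
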